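import Literature.NumberTheory.GaloisRepresentations.ArtinFormalismProofs
import Literature.NumberTheory.GaloisRepresentations.FramedRepDualProofs
import HarnessLib

/-!
# The Artin formalism for the completed L-function: equivalence and character invariance (proofs)
(companion to `Literature.NumberTheory.GaloisRepresentations.ArtinFormalism` and
`Literature.NumberTheory.GaloisRepresentations.ArtinLFunction`; serves the named fact
`Literature.NumberTheory.Automorphic.brauer_completedArtinLFunction_eq_prod_zpow` of
`Automorphic/ArtinLFunctionsFunctionalEquation`, Neukirch VII (12.3))

Neukirch, *Algebraic Number Theory*, VII §12 forms the completed Artin L-series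
`Λ(L|K, χ, s) = c(L|K, χ)^{s/2} 𝓛_∞(L|K, χ, s) 𝓛(L|K, χ, s)` (Def. (12.2)) as a function of the
*character* `χ`, i.e. of the equivalence class of the representation (VII §10, p. 522: "two
representations are equivalent if and only if their characters coincide"), and Prop. (12.3)
transfers to `Λ` the behaviour of `c` ((11.11)), `𝓛_∞` ((12.1)) and `𝓛` ((10.4)).  For the
tree's `completedArtinLFunction ρ s = A(ρ)^{s/2} γ(ρ, s) L(s, ρ)` — attached to a
*representation* `ρ : Γ_K → GL(V)` through `ArtinRep.artinConductorNorm`,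
`ArtinRep.gammaFactor` (signatures `ArtinRep.signature` of complex conjugations) and
`artinLFunction` — this file **proves** the implicit first step, that `Λ` only depends on the
equivalence class, and hence only on the character:

* `eigenspace_eq_map_of_semiconj`, `finrank_eigenspace_eq_of_semiconj` — an isomorphism
  intertwining `f` and `g` maps the `μ`-eigenspace of `f` onto that of `g`;
* `ArtinRep.signature_congr`, `ArtinRep.gammaFactor_congr` — equivalent Artin representations
  have the same signatures `(n⁺_w, n⁻_w)` at every real place and the same `Γ`-factor
  `γ(ρ, s)` (Neukirch's `𝓛_∞(L|K, χ, s)`, a function of `χ`);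
* `ContinuousRep.Equiv.map_fixedSubmodule`, `ContinuousRep.Equiv.codimFixed_eq`,
  `ArtinRep.artinConductorNat_congr`, `ArtinRep.artinConductorNorm_congr` — equivalent
  representations have the same `codim V^H` for every `H ≤ Γ_K`, hence (the conductor being a
  function of these codimensions, `GaloisRep.artinConductorNat_congr_codimFixed`) the same
  numerical Artin conductor and the same constant `A(ρ) = |d_K|^{dim V} N𝔣(ρ)` (Neukirch's
  `c(L|K, χ)`);
* `completedArtinLFunction_congr` — equivalent Artin representations have the same completed
  L-function; `completedArtinLFunction_eq_of_character_eq` — Artin representations on spaces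
  with their module topologies and with equal characters have the same completed L-function
  (`ContinuousRep.nonempty_equiv_of_character_eq`, Serre §2.3 Cor. 2).

Everything here is proved; no new definitions.  Also recorded: `Equiv.apply_eq_one_iff` and
`GaloisRep.isUnramifiedAt_congr` (equivalent representations are unramified at the same places).
Not treated here: the additivity (12.3) (i) of `Λ` in direct sums (for the tree's conductor ideal,
whose exponents are floors `⌊a_𝔓(ρ)⌋₊`, additivity needs the integrality of `a_𝔓(ρ)`, i.e.
Artin's theorem / Hasse–Arf, the named fact `hasseArf`), and the induction invariance
(12.3) (iii), which needs (11.7)/(11.11) (iii) and (12.1) (iii) (no Lean substrate at this pin).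

## Mathlib / tree search

Mathlib: `Module.End.eigenspace`, `Module.End.mem_eigenspace_iff`, `LinearEquiv.finrank_map_eq`,
`Submodule.Quotient.equiv`, `LinearEquiv.finrank_eq`; no lemma transporting eigenspaces along a
semiconjugacy (`eigenspace_conj_eq_map` of `ArtinLFunctionProofs` is the special case of an inner
conjugation).  Tree: `ContinuousRep.Equiv`, `Equiv.apply_apply`, `Equiv.fixedSubmoduleEquiv`
(`ArtinFormalism`), `artinLFunction_congr`, `GaloisRep.artinConductorNat_congr_codimFixed`
(`FramedRepDualProofs`), `ContinuousRep.nonempty_equiv_of_character_eq` (`ArtinFormalismProofs`);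
`lean search 'completedArtinLFunction'`: no invariance statement exists.  Nothing here duplicates
an existing declaration.

## References

* J. Neukirch, *Algebraic Number Theory* (1999), VII §10, p. 522; §12, Def. (12.2) and
  Prop. (12.3) (`NeukirchANT1999`).
* J.-P. Serre, *Linear Representations of Finite Groups* (1977), §2.3 Cor. 2
  (`SerreLinearRepresentations1977`).
* J.-P. Serre, *Local Fields* (1979), Ch. VI §2, Cor. 1' (the conductor as a function of the
  `codim V^{G_i}`) (`SerreLocalFields1979`).
-/

noncomputable section

open scoped NumberField
open Field IsDedekindDomain Module NumberField

namespace Literature.NumberTheory.GaloisRepresentations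

universe u v w w'

/-! ### Eigenspaces along intertwining isomorphisms -/

section Eigenspace

variable {R : Type*} [CommRing R] {M : Type*} {N : Type*} [AddCommGroup M] [Module R M]
  [AddCommGroup N] [Module R N]

/-- If the linear isomorphism `e : M ≃ N` intertwines `f ∈ End M` and `g ∈ End N`
(`e ∘ f = g ∘ e`), then the `μ`-eigenspace of `g` is the image under `e` of the `μ`-eigenspace of
`f`.  Ref: Birkhoff–Mac Lane, *A Survey of Modern Algebra*, §9.2 (eigenvectors of similar
operators). [folklore] -/
theorem eigenspace_eq_map_of_semiconj (e : M ≃ₗ[R] N) (f : Module.End R M) (g : Module.End R N)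
    (h : ∀ v, e (f v) = g (e v)) (μ : R) :
    Module.End.eigenspace g μ = (Module.End.eigenspace f μ).map (e : M →ₗ[R] N) := by
  ext w
  simp only [Module.End.mem_eigenspace_iff, Submodule.mem_map, LinearEquiv.coe_coe]
  constructor
  · intro hw
    refine ⟨e.symm w, ?_, e.apply_symm_apply w⟩
    apply e.injective
    rw [h, e.apply_symm_apply, map_smul, e.apply_symm_apply, hw]
  · rintro ⟨v, hv, rfl⟩
    rw [← h, hv, map_smul]

/-- Intertwined endomorphisms have eigenspaces of the same dimension
(`eigenspace_eq_map_of_semiconj` and Mathlib `LinearEquiv.finrank_map_eq`).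
Ref: Birkhoff–Mac Lane, *A Survey of Modern Algebra*, §9.2. [folklore] -/
theorem finrank_eigenspace_eq_of_semiconj (e : M ≃ₗ[R] N) (f : Module.End R M)
    (g : Module.End R N) (h : ∀ v, e (f v) = g (e v)) (μ : R) :
    finrank R (Module.End.eigenspace f μ) = finrank R (Module.End.eigenspace g μ) := by
  rw [eigenspace_eq_map_of_semiconj e f g h μ, LinearEquiv.finrank_map_eq]

end Eigenspace

/-! ### Signatures and `Γ`-factors of equivalent representations -/

namespace ArtinRep

section Signature

variable {K : Type u} [Field K] {V : Type w} [AddCommGroup V] [Module ℂ V] [TopologicalSpace V]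
  {V' : Type w'} [AddCommGroup V'] [Module ℂ V'] [TopologicalSpace V']

/-- **Equivalent Artin representations have the same signature** `(n⁺, n⁻)` at every real
embedding `φ`: an equivalence `e : ρ ≃ ρ'` intertwines `ρ(c)` and `ρ'(c)` for the complex
conjugation `c` used by `ArtinRep.signature`, so it matches their `±1`-eigenspaces.  (Neukirch's
`n⁺ = (χ(1) + χ(φ_𝔓))/2`, `n⁻ = (χ(1) - χ(φ_𝔓))/2` are functions of the character.)
Ref: Neukirch, *Algebraic Number Theory*, VII §12, before (12.1). [cite: NeukirchANT1999, VII §12, before (12.1)] -/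
theorem signature_congr {ρ : ArtinRep K V} {ρ' : ArtinRep K V'} (e : ContinuousRep.Equiv ρ ρ')
    (φ : K →+* ℝ) : ρ.signature φ = ρ'.signature φ := by
  simp only [signature]
  rw [finrank_eigenspace_eq_of_semiconj e.toLinearEquiv _ _ (fun v => e.apply_apply _ v) 1,
    finrank_eigenspace_eq_of_semiconj e.toLinearEquiv _ _ (fun v => e.apply_apply _ v) (-1)]

variable [NumberField K]

/-- **Equivalent Artin representations have the same archimedean `Γ`-factor** `γ(ρ, s)`
(same signatures, `signature_congr`, and same dimension).  This is the statement that
Neukirch's `𝓛_∞(L|K, χ, s)` is a function of the character `χ`.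
Ref: Neukirch, *Algebraic Number Theory*, VII §12, before (12.1) and Def. (12.2). [cite: NeukirchANT1999, VII §12, (12.2)] -/
theorem gammaFactor_congr {ρ : ArtinRep K V} {ρ' : ArtinRep K V'} (e : ContinuousRep.Equiv ρ ρ') :
    ρ.gammaFactor = ρ'.gammaFactor := by
  funext s
  simp only [gammaFactor, signature_congr e, e.toLinearEquiv.finrank_eq]

end Signature

end ArtinRep

/-! ### Fixed subspaces, codimensions and conductors of equivalent representations -/

namespace ContinuousRep

namespace Equiv

variable {G : Type*} [Group G] [TopologicalSpace G] {A : Type*} [CommRing A] [TopologicalSpace A]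
  {M : Type*} [AddCommGroup M] [Module A M] [TopologicalSpace M]
  {N : Type*} [AddCommGroup N] [Module A N] [TopologicalSpace N]
  {ρ : ContinuousRep G A M} {ρ' : ContinuousRep G A N}

/-- An equivalence `e : ρ ≃ ρ'` maps the `H`-fixed vectors of `ρ` onto those of `ρ'`
(`Submodule.map` form of `Equiv.fixedSubmoduleEquiv`).
Ref: Serre, *Linear Representations of Finite Groups*, §2.1. [folklore] -/
theorem map_fixedSubmodule (e : Equiv ρ ρ') (H : Subgroup G) :
    (ρ.fixedSubmodule H).map (e.toLinearEquiv : M →ₗ[A] N) = ρ'.fixedSubmodule H := by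
  ext w
  rw [Submodule.mem_map, ContinuousRep.mem_fixedSubmodule]
  constructor
  · rintro ⟨v, hv, rfl⟩ h hh
    rw [ContinuousRep.mem_fixedSubmodule] at hv
    change ρ' h (e.toLinearEquiv v) = e.toLinearEquiv v
    rw [← e.apply_apply, hv h hh]
  · intro hw
    refine ⟨e.toLinearEquiv.symm w, ?_, e.toLinearEquiv.apply_symm_apply w⟩
    rw [ContinuousRep.mem_fixedSubmodule]
    intro h hh
    apply e.toLinearEquiv.injective
    rw [e.apply_apply, LinearEquiv.apply_symm_apply, hw h hh]

/-- **Equivalent representations have fixed subspaces of the same codimension** `codim M^H`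
for every subgroup `H` (the quotients `M ⧸ M^H`, `N ⧸ N^H` are isomorphic,
Mathlib `Submodule.Quotient.equiv`).
Ref: Serre, *Local Fields*, Ch. VI §2 (`codim V^{G_i}` depends only on the class of `V`). [folklore] -/
theorem codimFixed_eq (e : Equiv ρ ρ') (H : Subgroup G) : ρ.codimFixed H = ρ'.codimFixed H := by
  unfold ContinuousRep.codimFixed
  exact LinearEquiv.finrank_eq
    (Submodule.Quotient.equiv _ _ e.toLinearEquiv (e.map_fixedSubmodule H))

/-- An equivalence preserves the elements acting trivially: `ρ g = 1 ↔ ρ' g = 1`. [folklore] -/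
theorem apply_eq_one_iff (e : Equiv ρ ρ') (g : G) : ρ g = 1 ↔ ρ' g = 1 := by
  constructor
  · intro h
    refine LinearMap.ext fun w => ?_
    obtain ⟨v, rfl⟩ := e.toLinearEquiv.surjective w
    rw [← e.apply_apply, h, Module.End.one_apply, Module.End.one_apply]
  · intro h
    refine LinearMap.ext fun v => ?_
    apply e.toLinearEquiv.injective
    rw [e.apply_apply, h, Module.End.one_apply, Module.End.one_apply]

end Equiv

end ContinuousRep

section Conductor

variable {K : Type u} [Field K] [NumberField K] {V : Type w} [AddCommGroup V] [Module ℂ V]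
  [TopologicalSpace V] {V' : Type w'} [AddCommGroup V'] [Module ℂ V'] [TopologicalSpace V']

/-- **Equivalent Artin representations have the same numerical Artin conductor** `N𝔣(ρ)`:
the conductor only sees `ρ` through the codimensions `codim V^H`
(`GaloisRep.artinConductorNat_congr_codimFixed`), which agree (`Equiv.codimFixed_eq`).  This is
the statement that Neukirch's `𝔣(L|K, χ)` is a function of the character `χ`.
Ref: Neukirch, *Algebraic Number Theory*, VII (11.6)–(11.7); Serre, *Local Fields*, Ch. VI §2,
Cor. 1'. [cite: SerreLocalFields1979, Ch. VI §2, Cor. 1'] -/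
theorem ArtinRep.artinConductorNat_congr {ρ : ArtinRep K V} {ρ' : ArtinRep K V'}
    (e : ContinuousRep.Equiv ρ ρ') :
    GaloisRep.artinConductorNat ρ = GaloisRep.artinConductorNat ρ' :=
  GaloisRep.artinConductorNat_congr_codimFixed fun H => e.codimFixed_eq H

/-- **Equivalent Artin representations have the same constant `A(ρ) = |d_K|^{dim V} N𝔣(ρ)`**
(Neukirch's `c(L|K, χ) = |d_K|^{χ(1)} 𝔑(𝔣(L|K, χ))`, a function of `χ`).
Ref: Neukirch, *Algebraic Number Theory*, VII §11, p. 533 and (11.11). [cite: NeukirchANT1999, VII (11.11)] -/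
theorem ArtinRep.artinConductorNorm_congr {ρ : ArtinRep K V} {ρ' : ArtinRep K V'}
    (e : ContinuousRep.Equiv ρ ρ') : ρ.artinConductorNorm = ρ'.artinConductorNorm := by
  rw [ArtinRep.artinConductorNorm, ArtinRep.artinConductorNorm, e.toLinearEquiv.finrank_eq,
    ArtinRep.artinConductorNat_congr e]

variable [FiniteDimensional ℂ V] [FiniteDimensional ℂ V']

/-- **The completed Artin L-function only depends on the equivalence class**: equivalent Artin
representations have the same `Λ(s, ρ) = A(ρ)^{s/2} γ(ρ, s) L(s, ρ)` (as functions on `ℂ`), by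
`artinConductorNorm_congr`, `gammaFactor_congr` and `artinLFunction_congr`.  Neukirch writes
`Λ(L|K, χ, s)` as a function of the character from the outset (VII (12.2)).
Ref: Neukirch, *Algebraic Number Theory*, VII §10, p. 522 and §12, Def. (12.2). [cite: NeukirchANT1999, VII (12.2)] -/
theorem completedArtinLFunction_congr {ρ : ArtinRep K V} {ρ' : ArtinRep K V'}
    (e : ContinuousRep.Equiv ρ ρ') : completedArtinLFunction ρ = completedArtinLFunction ρ' := by
  funext s
  rw [completedArtinLFunction, completedArtinLFunction, ArtinRep.artinConductorNorm_congr e,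
    ArtinRep.gammaFactor_congr e, artinLFunction_congr e]

/-- **The completed Artin L-function only depends on the character** (Neukirch VII §10,
p. 522 with §12 (12.2); Serre, *Linear Representations*, §2.3 Cor. 2).  Artin representations
of `K` on finite-dimensional spaces with their module topologies have open kernels
(`ArtinRep.isOpen_ker`), hence kernels of finite index; with equal characters they are
equivalent (`ContinuousRep.nonempty_equiv_of_character_eq`) and so have the same completed
L-function (`completedArtinLFunction_congr`).  This is the bookkeeping input of Brauer's
factorisation of `Λ` (proof of Neukirch VII (12.6)).
[cite: NeukirchANT1999, VII §10, p. 522] [cite: SerreLinearRepresentations1977, §2.3 Cor. 2] -/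
theorem completedArtinLFunction_eq_of_character_eq [IsModuleTopology ℂ V] [IsModuleTopology ℂ V']
    (ρ : ArtinRep K V) (ρ' : ArtinRep K V')
    (h : ∀ g, ρ.toRepresentation.character g = ρ'.toRepresentation.character g) :
    completedArtinLFunction ρ = completedArtinLFunction ρ' := by
  haveI : Finite (absoluteGaloisGroup K ⧸ ρ.ker) := Subgroup.quotient_finite_of_isOpen _ ρ.isOpen_ker
  haveI : Finite (absoluteGaloisGroup K ⧸ ρ'.ker) :=
    Subgroup.quotient_finite_of_isOpen _ ρ'.isOpen_ker
  haveI : ρ.ker.FiniteIndex := Subgroup.finiteIndex_of_finite_quotient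
  haveI : ρ'.ker.FiniteIndex := Subgroup.finiteIndex_of_finite_quotient
  obtain ⟨e⟩ := ContinuousRep.nonempty_equiv_of_character_eq ρ ρ' h
  exact completedArtinLFunction_congr e

omit [NumberField K] [FiniteDimensional ℂ V] [FiniteDimensional ℂ V'] in
/-- Equivalent Galois representations are unramified at the same places. [folklore] -/
theorem GaloisRep.isUnramifiedAt_congr {ρ : ArtinRep K V} {ρ' : ArtinRep K V'}
    (e : ContinuousRep.Equiv ρ ρ') (v : HeightOneSpectrum (𝓞 K)) :
    GaloisRep.IsUnramifiedAt v ρ ↔ GaloisRep.IsUnramifiedAt v ρ' :=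
  forall₂_congr fun _ _ => forall₂_congr fun g _ => e.apply_eq_one_iff g


end Conductor

end Literature.NumberTheory.GaloisRepresentations

end
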